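import Literature.AlgebraicGeometry.Resolution.KollarMaximalContact
import Literature.AlgebraicGeometry.Resolution.CanonicalResolutionSmoothCentre
import Literature.AlgebraicGeometry.Resolution.RegularBlowup
import HarnessLib

/-!
# A maximal-contact chart transforms to a maximal-contact chart under one admissible blow-up (BGMW 2011, Lemma 3.6.4 (2)–(5)), for an ARBITRARY model of the blow-up

Topic: `Literature/AlgebraicGeometry/Resolution`. Bierstone–Grigoriev–Milman–Włodarczyk,
arXiv:1206.3090, **Lemma 3.6.4** (Giraud; every characteristic): for a marked ideal `(𝓘, μ)`,
`u ∈ 𝒟^{μ-1}(𝓘)(U)` with `ord_x u = 1` on `V(u)`, and an admissible blow-up `σ` with centre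
`C ⊂ supp(𝓘, μ)`: "(2) `supp(𝓘, μ) ∩ U ⊂ V(u)`; (3) `u' := σᶜ(u) = y_exc^{-1} σ^*(u) ∈
𝒟^{μ-1}(𝓘')`; (4) `ord_{x'} u' = 1` for `x' ∈ V(u')`, so `V(u')` is smooth; (5)
`supp(𝓘', μ) ∩ U' ⊂ V(u')`." Kollár 2007 uses exactly this in the proof of Thm. 3.80 (1)
("`𝒪_{X_i}(-H_i) ⊂ J_i` for every `i` … Thus `Z_i ⊂ H_i`").

The tree proves the four clauses separately, at the level of ideal sheaves and for every
morphism `π` that IS a blow-up along `C` (`IsBlowup π C`, universal property — not only the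
chosen model `blowup C`): (3) `IsBlowup.transform_hypersurface_le`, (5)
`IsBlowup.support_transform_subset` (`MaximalContactPersistence.lean`), (4)
`IsBlowup.exists_generator_notMem_sq_controlledTransform` (`HypersurfaceTransform.lean`), (2)
`MarkedIdeal.support_subset_support_of_le_deriv`; and assembles them along the CHOSEN models in
`CentreSeq.centresOn_subschemeι_of_le_derivIdealSheafIter` (Kollár 3.80 (1)). This file packages
ONE STEP for an ARBITRARY model `π` — the form needed by procedures that blow up along their own
models (e.g. a typed blow-up datum `π : Z' → Z`, `IsBlowup π 𝓘_D`):

* `IsBlowup.maxContactChart_transform` — on a regular locally Noetherian `X` with `k`-structure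
  `φ` (finitely presented differentials on `X` and on `X'`), for `(I, m)` with `1 ≤ m`, a regular
  centre `V(C) ⊆ cosupp(I, m)` and a hypersurface ideal `H ⊆ 𝒟^{m-1}(I)` with order-one stalk
  generators on `V(H)` (a maximal-contact chart), and ANY blow-up `π : X' → X` along `C`: the
  weight-one controlled transform `H' = (π^*H : 𝓘_exc)` satisfies `H' ⊆ 𝒟^{m-1}(I')` for the
  controlled transform `I' = (π^*I : 𝓘_exc^m)`, has order-one stalk generators on `V(H')`,
  `cosupp(I', m) ⊆ V(H')`, and `X'` is regular — `(I', m; H')` is again a maximal-contact chart;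
* `le_centre_of_maxContactChart` — the centre lies on the hypersurface
  scheme-theoretically: `H ⊆ C` ("`Z_0 ⊂ H`").

## Sources

* E. Bierstone, D. Grigoriev, P. Milman, J. Włodarczyk, arXiv:1206.3090: Lemma 3.6.4 (2)–(5),
  Def. 3.1.3 (2). [BierstoneGrigorievMilmanWlodarczyk2011]
* J. Kollár, *Lectures on Resolution of Singularities* (2007): Thm. 3.80 (1), proof. [Kollar2007]
-/

noncomputable section

open CategoryTheory CategoryTheory.Limits AlgebraicGeometry TopologicalSpace IsLocalRing

namespace Literature.AlgebraicGeometry.Resolution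

universe u v

variable {k : Type v} [CommRing k] {X X' : Scheme.{u}} [IsLocallyNoetherian X] [IsLocallyNoetherian X']
  {φ : k →+* Γ(X, ⊤)} {π : X' ⟶ X} {C : X.IdealSheafData}

/-- **The centre lies on the hypersurface, scheme-theoretically** (Kollár 3.80 (1), first step:
"`ord_{Z_0} H ≥ 1` … Thus `Z_0 ⊂ H`"; BGMW Lemma 3.6.4 (2) with Def. 3.1.3 (2)): for `(I, m)`,
`1 ≤ m`, `H ⊆ 𝒟^{m-1}(I)` and a regular centre `V(C) ⊆ cosupp(I, m)` on a regular locally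
Noetherian `X`: `H ⊆ C`. [cite: Kollar2007, Thm. 3.80 (1) (proof)]
[cite: BierstoneGrigorievMilmanWlodarczyk2011, Lemma 3.6.4 (2)] -/
theorem le_centre_of_maxContactChart (hXd : HasFinitePresentationDifferentials φ)
    (hX : Scheme.IsRegular X) (hC : Scheme.IsRegular C.subscheme) (I : X.IdealSheafData) {m : ℕ}
    (hm : 1 ≤ m) (hsupp : (C.support : Set X) ⊆ (⟨I, [], m⟩ : MarkedIdeal X).support)
    {H : X.IdealSheafData} (hH : H ≤ derivIdealSheafIter φ (m - 1) I) : H ≤ C := by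
  have hsnc : HasSNCWith (⟨I, [], m⟩ : MarkedIdeal X).boundary C := hasSNCWith_nil_of_isRegular hX hC
  have hsuppH : (⟨I, [], m⟩ : MarkedIdeal X).support ⊆ (H.support : Set X) :=
    MarkedIdeal.support_subset_support_of_le_deriv hXd ⟨I, [], m⟩ hm hH
  exact le_of_support_subset_support (fun x hx => hsnc.isRsopGeneratedAt hx) (hsupp.trans hsuppH)

/-- **BGMW Lemma 3.6.4 (2)–(5) for one blow-up with an arbitrary model: a maximal-contact chart
transforms to a maximal-contact chart.** Let `X` be regular and locally Noetherian with a
`k`-structure `φ` having finitely presented differentials, `π : X' → X` ANY blow-up along `C`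
(`IsBlowup π C`; `X'` locally Noetherian, the induced `k`-structure with finitely presented
differentials), `V(C)` regular with `V(C) ⊆ cosupp(I, m)`, `1 ≤ m`, and `H ⊆ 𝒟^{m-1}(I)` an ideal
sheaf generated at each point of `V(H)` by an element of order one. Then for the controlled
transforms `I' = (π^*I : 𝓘_exc^m)` and `H' = (π^*H : 𝓘_exc)`: (3) `H' ⊆ 𝒟^{m-1}(I')`; (4) `H'` has
order-one stalk generators on `V(H')`; (5) `cosupp(I', m) ⊆ V(H')`; and `X'` is regular.
[cite: BierstoneGrigorievMilmanWlodarczyk2011, Lemma 3.6.4 (2)–(5)] [cite: Kollar2007, Thm. 3.80 (1) (proof)] -/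
theorem IsBlowup.maxContactChart_transform (hXd : HasFinitePresentationDifferentials φ)
    (hX'd : HasFinitePresentationDifferentials (π.appTop.hom.comp φ)) (hπ : IsBlowup π C)
    (hX : Scheme.IsRegular X) (hC : Scheme.IsRegular C.subscheme) (I : X.IdealSheafData) {m : ℕ}
    (hm : 1 ≤ m) (hsupp : (C.support : Set X) ⊆ (⟨I, [], m⟩ : MarkedIdeal X).support)
    {H : X.IdealSheafData} (hH : H ≤ derivIdealSheafIter φ (m - 1) I)
    (hreg : ∀ x ∈ H.support, ∃ v : X.presheaf.stalk x,
      stalkIdeal H x = Ideal.span {v} ∧ v ∉ (maximalIdeal (X.presheaf.stalk x)) ^ 2) :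
    controlledTransform π C H 1 ≤
        derivIdealSheafIter (π.appTop.hom.comp φ) (m - 1) (controlledTransform π C I m) ∧
      (∀ x' ∈ (controlledTransform π C H 1).support, ∃ w : X'.presheaf.stalk x',
        stalkIdeal (controlledTransform π C H 1) x' = Ideal.span {w} ∧
          w ∉ (maximalIdeal (X'.presheaf.stalk x')) ^ 2) ∧
      (⟨controlledTransform π C I m, [], m⟩ : MarkedIdeal X').support ⊆
        ((controlledTransform π C H 1).support : Set X') ∧
      Scheme.IsRegular X' := by
  set M : MarkedIdeal X := ⟨I, [], m⟩ with hM
  have hsnc : HasSNCWith M.boundary C := hasSNCWith_nil_of_isRegular hX hC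
  have hHC : H ≤ C := le_centre_of_maxContactChart hXd hX hC I hm hsupp hH
  refine ⟨?_, ?_, ?_, hπ.isRegular_of_isRegular_subscheme hX hC⟩
  · have h := hπ.transform_hypersurface_le hXd hX'd M hm hsupp hsnc hH
    simpa [M] using h
  · exact fun x' hx' => hπ.exists_generator_notMem_sq_controlledTransform hX hC hHC hreg x' hx'
  · have h := hπ.support_transform_subset hXd hX'd M hm hsupp hsnc hH
    exact h

end Literature.AlgebraicGeometry.Resolution

end
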